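import Summits.AtomisticToContinuum.HydrodynamicLimit.Theorems.CollisionIsometryCLTAdaptedWeightCLTTLPastDampingIntegrated
import Summits.AtomisticToContinuum.HydrodynamicLimit.Theorems.CollisionIsometryCLTAdaptedWeightCLTTLPastDampingScales
import Summits.AtomisticToContinuum.HydrodynamicLimit.Theorems.CollisionIsometryCLTAdaptedWeightCLTTLPastDampingLocality
import Summits.AtomisticToContinuum.HydrodynamicLimit.Theorems.CollisionIsometryCLTAdaptedWeightCLTTLPastDampingWindows

/-!
# Stub `stub_pastDamping` of the line `contact-source-duhamel` — helper file: the PAST INEQUALITY ON A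
HORIZON, pathwise (crux `CollisionIsometryCLT.AdaptedWeightCLT`, stmt-AtomisticToContinuum-14868,
`--supports`)

The `x`-integrated PAST inequality of `…TLPastDampingIntegrated.lean`, integrated over `s ∈ [0, t]`
along ONE good orbit that satisfies the two per-horizon constraints the probability layer supplies —
the time-averaged exponential velocity moment `∫₀ᵗ expMoment(Φ_s z) ds ≤ Cexp` (complement of the
`TailsOn` event) and the time-integrated number of fold steps `∫₀ᵗ #steps ds ≤ M` (complement of the
`FewStepsOn` event) — with the density cap in uniform form (`Wm = 27 C σ⁻³ (N+1)`,
`…TLPastDampingScales`):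

  `∫₀ᵗ ∫ₓ PastSq ≤ κ₀ · [(V⁴ + V⁶) ∫₀ᵗ cdWin ds + 6 (V⁴ + V⁶) (lipK Δℓ_N) √(Cexp/(λt)) t`
  `+ 6 (V⁴ + V⁶) (lipK ε_N/(N+1)) M + 13 (4!/(λV)⁴ + 6!/(λV)⁶) Cexp]`,   `κ₀ = 10⁸ · 27 C σ⁻³`

(`horizon_bound`): the first bracket term is the only random one (its mean tends to `0` by column
depolarisation and dominated convergence in the horizon), the second tends to `0` deterministically
(`lipK Δℓ_N → 0`), the third is `O(δ')` on the few-steps event (`lipK ε_N (N+1)^{4/15} = O(1)`), the last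
is `O(V⁻⁴)` uniformly in `N`.
-/

namespace Summit.AtomisticToContinuum.HydrodynamicLimit.Theorems.ContactSourceDuhamel.TimeLocal
namespace PastDamping

open scoped BigOperators Topology Classical MeasureTheory ENNReal InnerProductSpace
open Filter Set MeasureTheory
open Literature.Analysis.FluidPDE
open Literature.MathematicalPhysics.KineticTheory (hsDiameter hsDiameter_pos)

noncomputable section

variable {σ : ℝ} {N : ℕ}

/-- The constant of the PAST estimate: `κ₀ = 10⁸ · 27 C σ⁻³`. -/
def kappa0 (C σ : ℝ) : ℝ := 10 ^ 8 * (27 * C * σ⁻¹ ^ 3)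

/-- The cut-off constant `4!/(λV)⁴ + 6!/(λV)⁶`. -/
def cut46 (lam V : ℝ) : ℝ :=
  ((4 : ℕ).factorial : ℝ) / (lam * V) ^ 4 + ((6 : ℕ).factorial : ℝ) / (lam * V) ^ 6

/-- `0 ≤ cut46` (even powers; `x/0 = 0`). -/
theorem cut46_nonneg (lam V : ℝ) : 0 ≤ cut46 lam V := by
  unfold cut46; positivity

/-- **The PAST inequality at one time, uniform form** (good orbit, density cap, `Σ dep = (N+1) cd`):
`∫ₓ PastSq(s) ≤ κ₀ [V⁴ cd2 + V⁶ cd3x + (V⁴+V⁶) lipK (6 (S̄/(N+1)) winLen + 6 ε_N m/(N+1))`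
`+ cut46 (6 expMoment(y_s) + expMoment(Φ_s z))]`. -/
theorem integral_pastSq_le_uniform (hσ : 0 < σ) (hσ2 : σ < 2⁻¹) (Φ : Flow σ N) {γ C : ℝ}
    {φ : ℕ → T3 → ℝ} (hadm : AdmissibleKernel γ C φ) (hγ3 : γ ≤ 1 / 3)
    (hN1 : ((N : ℝ) + 1) ^ (-γ) < 1 / 2) (hN2 : ((N : ℝ) + 1) ^ (-γ) + hsDiameter σ N / 2 < 1 / 2)
    {z : Cfg N} (hz : z ∈ Φ.good) (s : ℝ) {V lam : ℝ} (hV : 0 < V) (hlam : 0 < lam) :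
    ∫ x, PastSq σ N Φ φ s z x ≤ kappa0 C σ *
      (V ^ 4 * cd2 σ N (winStart σ N Φ s z) (winLen N s) + V ^ 6 * cd3x σ N (winStart σ N Φ s z) (winLen N s) +
        (V ^ 4 + V ^ 6) * (lipK C γ N * (6 * (sBar N z / ((N + 1 : ℕ) : ℝ)) * winLen N s +
          6 * hsDiameter σ N * (steps σ N (winStart σ N Φ s z) (winLen N s) : ℝ) / ((N + 1 : ℕ) : ℝ))) +
        cut46 lam V * (6 * expMoment lam N (winStart σ N Φ s z) + expMoment lam N (Φ.flow s z))) := by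
  have hN : (0 : ℝ) < ((N + 1 : ℕ) : ℝ) := by positivity
  have hσ1 : σ ≤ 1 := by linarith [show (2 : ℝ)⁻¹ ≤ 1 by norm_num]
  set Wm : ℝ := 27 * C * σ⁻¹ ^ 3 * ((N + 1 : ℕ) : ℝ) with hWm
  have hcap : ∀ x, ∑ i, wgt σ N Φ φ s z x i ≤ Wm := fun x =>
    sum_wgt_le_uniform hσ hσ1 Φ hadm hγ3 hN2 s z (flow_mem_hardSphereDomain Φ hz s) x
  have h := integral_pastSq_le Φ hadm hN1 z s hV hlam hcap (locality_win hσ hσ2 Φ hz s)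
  -- `Σ_k dep = (N+1) cd`
  have hd2 : ∑ k, dep2 σ N (winStart σ N Φ s z) (steps σ N (winStart σ N Φ s z) (winLen N s)) k =
      ((N + 1 : ℕ) : ℝ) * cd2 σ N (winStart σ N Φ s z) (winLen N s) := by
    rw [cd2_eq_avg_dep2, ← mul_assoc, mul_inv_cancel₀ hN.ne', one_mul]
  have hd3 : ∑ k, dep3 σ N (winStart σ N Φ s z) (steps σ N (winStart σ N Φ s z) (winLen N s)) k =
      ((N + 1 : ℕ) : ℝ) * cd3x σ N (winStart σ N Φ s z) (winLen N s) := by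
    rw [cd3x_eq_avg_dep3, ← mul_assoc, mul_inv_cancel₀ hN.ne', one_mul]
  rw [hd2, hd3] at h
  refine h.trans (le_of_eq ?_)
  rw [kappa0, cut46, hWm]
  field_simp
  ring

/-! ## The horizon bound -/

/-- The velocity scale on the tails event: `S̄(z)/(N+1) ≤ √(Cexp/(λt))`. -/
theorem sBar_div_le {lam : ℝ} (hlam : 0 < lam) (Φ : Flow σ N) {z : Cfg N} (hz : z ∈ Φ.good)
    {t Cexp : ℝ} (ht : 0 < t) (hT : ∫ s in Icc 0 t, expMoment lam N (Φ.flow s z) ≤ Cexp) :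
    sBar N z / ((N + 1 : ℕ) : ℝ) ≤ Real.sqrt (Cexp / (lam * t)) := by
  have hN : (0 : ℝ) < ((N + 1 : ℕ) : ℝ) := by positivity
  have hE := sum_sq_le_of_tails hlam Φ hz ht hT
  have hC0 : 0 ≤ Cexp :=
    (setIntegral_nonneg measurableSet_Icc fun s _ => expMoment_nonneg lam N (Φ.flow s z)).trans hT
  have hq : 0 ≤ Cexp / (lam * t) := div_nonneg hC0 (mul_pos hlam ht).le
  rw [div_le_iff₀ hN, sBar]
  have hsq : Real.sqrt (Cexp / (lam * t)) * ((N + 1 : ℕ) : ℝ) =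
      Real.sqrt ((((N + 1 : ℕ) : ℝ)) ^ 2 * (Cexp / (lam * t))) := by
    rw [Real.sqrt_mul' _ hq, Real.sqrt_sq hN.le, mul_comm]
  rw [hsq]
  refine Real.sqrt_le_sqrt ?_
  calc ((N + 1 : ℕ) : ℝ) * ∑ j, ‖(z j).2‖ ^ 2 ≤ ((N + 1 : ℕ) : ℝ) * (((N + 1 : ℕ) : ℝ) * Cexp / (lam * t)) :=
        mul_le_mul_of_nonneg_left hE hN.le
    _ = ((N + 1 : ℕ) : ℝ) ^ 2 * (Cexp / (lam * t)) := by ring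

/-- `0 ≤ κ₀` for `C ≥ 0`, `σ > 0`. -/
theorem kappa0_nonneg {C σ : ℝ} (hC : 0 ≤ C) (hσ : 0 < σ) : 0 ≤ kappa0 C σ := by
  unfold kappa0; positivity

/-- The constant of an admissible kernel family is non-negative. -/
theorem adm_const_nonneg {γ C : ℝ} {φ : ℕ → T3 → ℝ} (hadm : AdmissibleKernel γ C φ) : 0 ≤ C := by
  have h := (hadm.2.1 0 0).trans (hadm.2.2.2.2.1 0 0)
  have hpow : 0 < ((0 : ℕ) : ℝ) + 1 := by norm_num
  have : 0 < (((0 : ℕ) : ℝ) + 1) ^ (3 * γ) := Real.rpow_pos_of_pos hpow _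
  nlinarith

/-- Linearity of the integral over four integrable terms with constant coefficients. -/
theorem integral_lin4 {α : Type*} [MeasurableSpace α] {μ : Measure α} {f₁ f₂ f₃ f₄ : α → ℝ}
    (h₁ : Integrable f₁ μ) (h₂ : Integrable f₂ μ) (h₃ : Integrable f₃ μ) (h₄ : Integrable f₄ μ)
    (a b c d : ℝ) :
    ∫ x, (a * f₁ x + b * f₂ x + c * f₃ x + d * f₄ x) ∂μ =
      a * (∫ x, f₁ x ∂μ) + b * (∫ x, f₂ x ∂μ) + c * (∫ x, f₃ x ∂μ) + d * (∫ x, f₄ x ∂μ) := by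
  have i1 : Integrable (fun x => a * f₁ x) μ := h₁.const_mul a
  have i2 : Integrable (fun x => b * f₂ x) μ := h₂.const_mul b
  have i3 : Integrable (fun x => c * f₃ x) μ := h₃.const_mul c
  have i4 : Integrable (fun x => d * f₄ x) μ := h₄.const_mul d
  have i12 : Integrable (fun x => a * f₁ x + b * f₂ x) μ := i1.add i2
  have i123 : Integrable (fun x => a * f₁ x + b * f₂ x + c * f₃ x) μ := i12.add i3
  rw [integral_add i123 i4, integral_add i12 i3, integral_add i1 i2, integral_const_mul, integral_const_mul,
    integral_const_mul, integral_const_mul]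

/-- **THE PAST INEQUALITY ON A HORIZON, pathwise.** See the module docstring. -/
theorem horizon_bound (hσ : 0 < σ) (hσ2 : σ < 2⁻¹) (Φ : Flow σ N) {γ C : ℝ} {φ : ℕ → T3 → ℝ}
    (hadm : AdmissibleKernel γ C φ) (hγ3 : γ ≤ 1 / 3)
    (hN1 : ((N : ℝ) + 1) ^ (-γ) < 1 / 2) (hN2 : ((N : ℝ) + 1) ^ (-γ) + hsDiameter σ N / 2 < 1 / 2)
    {z : Cfg N} (hz : z ∈ Φ.good) {t : ℝ} (ht : 0 < t) {V lam Cexp M : ℝ} (hV : 0 < V) (hlam : 0 < lam)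
    (hT : ∫ s in Icc 0 t, expMoment lam N (Φ.flow s z) ≤ Cexp)
    (hM : ∫ s in Icc 0 t, (steps σ N (winStart σ N Φ s z) (winLen N s) : ℝ) ≤ M) :
    ∫ s in Icc 0 t, ∫ x, PastSq σ N Φ φ s z x ≤ kappa0 C σ *
      ((V ^ 4 + V ^ 6) * (∫ s in Icc 0 t, cdSum σ N (winStart σ N Φ s z) (winLen N s)) +
        6 * (V ^ 4 + V ^ 6) * (lipK C γ N * Δℓ N) * (Real.sqrt (Cexp / (lam * t)) * t) +
        6 * (V ^ 4 + V ^ 6) * (lipK C γ N * hsDiameter σ N / ((N + 1 : ℕ) : ℝ)) * M +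
        13 * cut46 lam V * Cexp) := by
  have hG := FlowDict.regular_hsDiameter hσ.le hσ2 N
  have hN : (0 : ℝ) < ((N + 1 : ℕ) : ℝ) := by positivity
  have hC0 : 0 ≤ C := adm_const_nonneg hadm
  have hK0 : 0 ≤ kappa0 C σ := kappa0_nonneg hC0 hσ
  have hL0 : 0 ≤ lipK C γ N := lipK_nonneg hC0 γ N
  have hε0 : 0 ≤ hsDiameter σ N := (hsDiameter_pos hσ N).le
  have hV46 : 0 ≤ V ^ 4 + V ^ 6 := by positivity
  have hcut : 0 ≤ cut46 lam V := cut46_nonneg lam V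
  set S₀ := Real.sqrt (Cexp / (lam * t)) with hS₀
  have hS₀0 : 0 ≤ S₀ := Real.sqrt_nonneg _
  have hS : sBar N z / ((N + 1 : ℕ) : ℝ) ≤ S₀ := sBar_div_le hlam Φ hz ht hT
  -- the five time-dependent data
  set cdW : ℝ → ℝ := fun s => cdSum σ N (winStart σ N Φ s z) (winLen N s) with hcdW
  set mS : ℝ → ℝ := fun s => (steps σ N (winStart σ N Φ s z) (winLen N s) : ℝ) with hmS
  set eMy : ℝ → ℝ := fun s => expMoment lam N (winStart σ N Φ s z) with heMy
  set eMZ : ℝ → ℝ := fun s => expMoment lam N (Φ.flow s z) with heMZ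
  set a : ℝ := kappa0 C σ * ((V ^ 4 + V ^ 6) * (lipK C γ N * (6 * S₀))) with ha
  set b : ℝ := kappa0 C σ * ((V ^ 4 + V ^ 6) * (lipK C γ N * (6 * hsDiameter σ N / ((N + 1 : ℕ) : ℝ))))
    with hb
  set c : ℝ := kappa0 C σ * (cut46 lam V * 6) with hc
  set d : ℝ := kappa0 C σ * cut46 lam V with hd
  have ha0 : 0 ≤ a := by rw [ha]; positivity
  have hb0 : 0 ≤ b := by rw [hb]; positivity
  have hc0 : 0 ≤ c := by rw [hc]; positivity
  have hd0 : 0 ≤ d := by rw [hd]; positivity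
  set R : ℝ → ℝ := fun s => kappa0 C σ * ((V ^ 4 + V ^ 6) * cdW s) +
    (a * winLen N s + b * mS s + c * eMy s + d * eMZ s) with hR
  -- pointwise majorant
  have hpt : ∀ s, ∫ x, PastSq σ N Φ φ s z x ≤ R s := by
    intro s
    have h := integral_pastSq_le_uniform hσ hσ2 Φ hadm hγ3 hN1 hN2 hz s hV hlam
    have hcd2 := ColumnDepolarisation.cd2_nonneg (σ := σ) (y := winStart σ N Φ s z) (winLen N s)
    have hcd3 := ColumnDepolarisation.cd3x_nonneg (σ := σ) (y := winStart σ N Φ s z) (winLen N s)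
    have hwl : 0 ≤ winLen N s := Reduction.winLen_nonneg N s
    have hms : 0 ≤ mS s := Nat.cast_nonneg _
    have hV4 : 0 ≤ V ^ 4 := by positivity
    have hV6 : 0 ≤ V ^ 6 := by positivity
    -- `V⁴ cd2 + V⁶ cd3x ≤ (V⁴ + V⁶) cdSum` and `S̄/(N+1) ≤ S₀`
    have h1 : V ^ 4 * cd2 σ N (winStart σ N Φ s z) (winLen N s) +
        V ^ 6 * cd3x σ N (winStart σ N Φ s z) (winLen N s) ≤ (V ^ 4 + V ^ 6) * cdW s := by
      rw [hcdW]; simp only [cdSum]; nlinarith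
    have h2 : lipK C γ N * (6 * (sBar N z / ((N + 1 : ℕ) : ℝ)) * winLen N s +
        6 * hsDiameter σ N * (steps σ N (winStart σ N Φ s z) (winLen N s) : ℝ) / ((N + 1 : ℕ) : ℝ)) ≤
        lipK C γ N * (6 * S₀ * winLen N s + 6 * hsDiameter σ N / ((N + 1 : ℕ) : ℝ) * mS s) := by
      refine mul_le_mul_of_nonneg_left ?_ hL0
      have := mul_le_mul_of_nonneg_right hS hwl
      rw [hmS]; simp only
      have : 6 * hsDiameter σ N * (steps σ N (winStart σ N Φ s z) (winLen N s) : ℝ) / ((N + 1 : ℕ) : ℝ) =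
          6 * hsDiameter σ N / ((N + 1 : ℕ) : ℝ) * (steps σ N (winStart σ N Φ s z) (winLen N s) : ℝ) := by
        ring
      rw [this]
      nlinarith
    refine h.trans ?_
    rw [hR, ha, hb, hc, hd, heMy, heMZ]
    simp only
    have h3 := mul_le_mul_of_nonneg_left h2 hV46
    have hA := mul_le_mul_of_nonneg_left (add_le_add h1 h3) hK0
    linarith [hA]
  -- integrability on the horizon
  have hIcd : IntegrableOn cdW (Icc 0 t) := by
    have hm : Measurable cdW := by
      have heq : cdW = fun s => cdWinMod σ N Φ (s, z) := funext fun s => (cdWinMod_eq_of_mem Φ hz s).symm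
      rw [heq]
      exact (measurable_cdWinMod hG Φ).comp (measurable_id.prodMk measurable_const)
    refine IntegrableOn.of_bound measure_Icc_lt_top hm.aestronglyMeasurable.restrict 84 (ae_of_all _ fun s => ?_)
    rw [Real.norm_eq_abs, abs_of_nonneg (cdSum_mem σ N _ _).1]
    exact (cdSum_mem σ N _ _).2
  have hIwl : IntegrableOn (winLen N) (Icc 0 t) := by
    refine IntegrableOn.of_bound measure_Icc_lt_top (Reduction.measurable_winLen N).aestronglyMeasurable.restrict
      (Δℓ N) (ae_of_all _ fun s => ?_)
    rw [Real.norm_eq_abs, abs_of_nonneg (Reduction.winLen_nonneg N s)]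
    unfold winLen; split_ifs; exacts [(ColumnDepolarisation.lineWindow_pos N).le, le_rfl]
  have hIm : IntegrableOn mS (Icc 0 t) := by
    refine IntegrableOn.of_bound measure_Icc_lt_top
      (measurable_steps_win_real hG Φ hz).aestronglyMeasurable.restrict
      (((Φ.isTrajectory z hz).locFinite 0 t).toFinset.card : ℝ) ?_
    refine (ae_restrict_iff' measurableSet_Icc).2 (ae_of_all _ fun s hs => ?_)
    rw [hmS, Real.norm_eq_abs, abs_of_nonneg (Nat.cast_nonneg _)]
    dsimp only
    exact_mod_cast Reduction.steps_win_le hG Φ hz hs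
  have hIy : IntegrableOn eMy (Icc 0 t) := by
    refine IntegrableOn.of_bound measure_Icc_lt_top ((measurable_expMoment lam N).comp
      (Reduction.measurable_winStart Φ hz)).aestronglyMeasurable.restrict (Real.exp (lam * Reduction.vR z ^ 2))
      (ae_of_all _ fun s => ?_)
    rw [heMy, Real.norm_eq_abs, abs_of_nonneg (expMoment_nonneg lam N _)]
    exact expMoment_flow_le hlam.le Φ hz _
  have hIZ : IntegrableOn eMZ (Icc 0 t) := integrableOn_expMoment_flow hlam.le Φ hz 0 t
  have hI1 : IntegrableOn (fun s => kappa0 C σ * ((V ^ 4 + V ^ 6) * cdW s)) (Icc 0 t) :=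
    (hIcd.const_mul (V ^ 4 + V ^ 6)).const_mul (kappa0 C σ)
  have hI2 : IntegrableOn (fun s => a * winLen N s + b * mS s + c * eMy s + d * eMZ s) (Icc 0 t) :=
    (((hIwl.const_mul a).add (hIm.const_mul b)).add (hIy.const_mul c)).add (hIZ.const_mul d)
  have hIR : IntegrableOn R (Icc 0 t) := hI1.add hI2
  -- integrate the majorant
  have hint : ∫ s in Icc 0 t, ∫ x, PastSq σ N Φ φ s z x ≤ ∫ s in Icc 0 t, R s :=
    integral_mono_of_nonneg (ae_of_all _ fun s => integral_nonneg fun x => pastSq_nonneg Φ φ s z x) hIR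
      (ae_of_all _ hpt)
  have hRint : ∫ s in Icc 0 t, R s = kappa0 C σ * ((V ^ 4 + V ^ 6) * ∫ s in Icc 0 t, cdW s) +
      (a * (∫ s in Icc 0 t, winLen N s) + b * (∫ s in Icc 0 t, mS s) + c * (∫ s in Icc 0 t, eMy s) +
        d * (∫ s in Icc 0 t, eMZ s)) := by
    rw [hR]
    dsimp only
    rw [integral_add hI1 hI2, integral_lin4 hIwl hIm hIy hIZ, integral_const_mul, integral_const_mul]
  -- the four deterministic/hypothesised integrals
  have hwl : ∫ s in Icc 0 t, winLen N s ≤ Δℓ N * t := by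
    calc ∫ s in Icc 0 t, winLen N s ≤ ∫ _s in Icc 0 t, Δℓ N :=
          setIntegral_mono_on hIwl (integrableOn_const measure_Icc_lt_top.ne) measurableSet_Icc fun s _ => by
            unfold winLen; split_ifs; exacts [(ColumnDepolarisation.lineWindow_pos N).le, le_rfl]
      _ = Δℓ N * t := by
          rw [setIntegral_const, smul_eq_mul, measureReal_def, Real.volume_Icc, sub_zero,
            ENNReal.toReal_ofReal ht.le, mul_comm]
  have hy2 : ∫ s in Icc 0 t, eMy s ≤ 2 * Cexp :=
    (integral_expMoment_winStart_le hlam.le Φ hz t).trans (by linarith)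
  rw [hRint] at hint
  refine hint.trans ?_
  have e1 := mul_le_mul_of_nonneg_left hwl ha0
  have e2 := mul_le_mul_of_nonneg_left hM hb0
  have e3 := mul_le_mul_of_nonneg_left hy2 hc0
  have e4 := mul_le_mul_of_nonneg_left hT hd0
  have hfin : kappa0 C σ * ((V ^ 4 + V ^ 6) * ∫ s in Icc 0 t, cdW s) +
      (a * (Δℓ N * t) + b * M + c * (2 * Cexp) + d * Cexp) = kappa0 C σ *
      ((V ^ 4 + V ^ 6) * (∫ s in Icc 0 t, cdSum σ N (winStart σ N Φ s z) (winLen N s)) +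
        6 * (V ^ 4 + V ^ 6) * (lipK C γ N * Δℓ N) * (Real.sqrt (Cexp / (lam * t)) * t) +
        6 * (V ^ 4 + V ^ 6) * (lipK C γ N * hsDiameter σ N / ((N + 1 : ℕ) : ℝ)) * M +
        13 * cut46 lam V * Cexp) := by
    rw [ha, hb, hc, hd, hS₀, hcdW]
    ring
  linarith [e1, e2, e3, e4, hfin.le]

/-- Registered anchor of this helper file (the cut-off constant is non-negative, `cut46` unfolded). -/
theorem pastDamping_horizon_anchor : ∀ (lam V : ℝ), 0 ≤ ((4 : ℕ).factorial : ℝ) / (lam * V) ^ 4 + ((6 : ℕ).factorial : ℝ) / (lam * V) ^ 6 :=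
  fun lam V => cut46_nonneg lam V

end

end PastDamping
end Summit.AtomisticToContinuum.HydrodynamicLimit.Theorems.ContactSourceDuhamel.TimeLocal
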